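import Summits.Ventures.YMGap.RobustBall.TorusOneLink
import HarnessLib

/-!
# Venture YMGap, track ROBUST-BALL (Y2) — finite range of the one-link law of the perturbed TORUS
specification (bookkeeping for the tier-1 door)

HONEST FRAMING. WHAT THIS IS: a venture file (cell `pub-ymgap`, track Y2 ROBUST-BALL, seat ds-2): the LOCALITY of
the one-link conditional law of `perturbedTorusSpec W β` (`RobustBall/Defs`). The law at the link `e` is the Haar tilt
by the LOCAL energy `∑_{q ∋ e} log v_β((η^{e←g})_q) − h_{W,e,η}(g)` (plaquettes and polymers away from `e` cancel in the
normalisation); hence (i) boundary conditions agreeing off `e` give the same law, and (ii) under the finite-range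
hypothesis `HasRange r W` (activities of polymers of diameter `> r` vanish) the law depends on the boundary condition
only through the links `y ≠ e` with `‖e − y‖_∞ ≤ r ⊔ 1` — plaquette neighbours at distance `≤ 1`, links of active
polymers through `e` at distance `≤ r` (two links of a polymer are at distance at most its diameter). This is the
`siteLaw_congr` field of Dobrushin's condition for the tier-1 ball with neighbourhoods of range `r ⊔ 1` (`TorusDoor`).
WHAT THIS IS NOT: no estimate, no Dobrushin matrix, no number; finite-torus bookkeeping only — no continuum claim.

## References
* H. Föllmer, LNM 1362 (1988), Ch. I (2.20) (finite range of the one-site kernels).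
* E. Seiler, LNP 159 (1982), Ch. 2; the tree: `PlaquetteWeightTorusDobrushin.lean` (`siteLaw_torusWeightSpec_congr`,
  the `W = 0` template).
-/

noncomputable section

open MeasureTheory ProbabilityTheory Finset Function Real
open Literature.Probability.LatticeModels Literature.Probability.LatticeModels.DobrushinMetric
open Literature.MathematicalPhysics.QuantumLattice hiding torusNorm
open Literature.MathematicalPhysics.QuantumFieldTheory hiding ZdEdge
open Literature.MathematicalPhysics.QuantumFieldTheory.Balaban1983to89.StrongCouplingTorusWindow

namespace Summit.Ventures.YMGap.RobustBall

variable {d L N : ℕ} [NeZero L] {W : Perturbation d L N}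

/-- Boundary conditions agreeing off `e` have the same one-link law at `e`. [folklore] -/
theorem siteLaw_perturbedTorusSpec_congr_off (β : ℝ) (e : Edge d L) {η η' : GaugeConfig d L (SUN N)}
    (h : ∀ z, z ≠ e → η z = η' z) : siteLaw (perturbedTorusSpec W β) e η = siteLaw (perturbedTorusSpec W β) e η' := by
  rw [siteLaw_perturbedTorusSpec_eq_tilted_haar, siteLaw_perturbedTorusSpec_eq_tilted_haar]
  have hupd : ∀ g : SUN N, update η e g = update η' e g := fun g => by
    funext z
    by_cases hz : z = e
    · subst hz; simp
    · rw [update_of_ne hz, update_of_ne hz, h z hz]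
  simp_rw [hupd]

/-- **The local form of the one-link law**: `γ^{W,β}_e(· | η) = σ_N.tilted (∑_{q ∋ e} log v_β((η^{e←g})_q) − h_{W,e,η}(g))`
(the plaquettes and polymers away from `e` cancel in the normalisation). [folklore] -/
theorem siteLaw_perturbedTorusSpec_eq_tilted_local (β : ℝ) (e : Edge d L) (η : GaugeConfig d L (SUN N)) :
    siteLaw (perturbedTorusSpec W β) e η = (haarProbability (SUN N)).tilted fun g =>
      (∑ q ∈ plaqsThrough e, Real.log (wilsonPlaqWeight N β (plaquetteHolonomy (update η e g) q.1 q.2.1.1 q.2.1.2))) -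
        localTilt W e η g := by
  classical
  rw [siteLaw_perturbedTorusSpec_eq_tilted_haar]
  set c₁ : ℝ := ∑ q ∈ (plaqsThrough e)ᶜ,
    Real.log (wilsonPlaqWeight N β (plaquetteHolonomy η q.1 q.2.1.1 q.2.1.2)) with hc₁
  set c₃ : ℝ := ∑ X ∈ (polymers (d := d) (L := L) 1).filter (fun X => e.1 ∉ X), W.act X η with hc₃
  have hsplit : (fun g : SUN N =>
      torusLogWeight (wilsonPlaqWeight N β) (update η e g) - W.total (update η e g)) =
      fun g => (c₁ - c₃) + ((∑ q ∈ plaqsThrough e,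
        Real.log (wilsonPlaqWeight N β (plaquetteHolonomy (update η e g) q.1 q.2.1.1 q.2.1.2))) - localTilt W e η g) := by
    funext g
    rw [torusLogWeight_update_eq, total_update_eq]
    ring
  rw [hsplit, tilted_const_add_eq]

/-- The local Wilson energy at `e` sees the boundary condition only on the plaquette neighbours of `e`. [folklore] -/
theorem localLogWeight_congr (β : ℝ) (e : Edge d L) {η η' : GaugeConfig d L (SUN N)}
    (h : ∀ z ∈ linkNbrT e, η z = η' z) (g : SUN N) :
    (∑ q ∈ plaqsThrough e, Real.log (wilsonPlaqWeight N β (plaquetteHolonomy (update η e g) q.1 q.2.1.1 q.2.1.2))) =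
      ∑ q ∈ plaqsThrough e, Real.log (wilsonPlaqWeight N β (plaquetteHolonomy (update η' e g) q.1 q.2.1.1 q.2.1.2)) := by
  refine Finset.sum_congr rfl fun q hq => ?_
  rw [mem_plaqsThrough] at hq
  have hh : plaquetteHolonomy (update η e g) q.1 q.2.1.1 q.2.1.2 = plaquetteHolonomy (update η' e g) q.1 q.2.1.1 q.2.1.2 := by
    refine dependsOn_plaquetteHolonomy q fun z hz => ?_
    by_cases hze : z = e
    · subst hze; simp
    · rw [update_of_ne hze, update_of_ne hze]
      exact h z (mem_linkNbrT_iff.2 ⟨hze, q, hq, hz⟩)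
  rw [hh]

omit [NeZero L] in
/-- Two links of one polymer are at torus distance at most its diameter. [folklore] -/
theorem torusNorm_sub_le_polymerDiam {X : Finset (Site d L)} {x y : Site d L} (hx : x ∈ X) (hy : y ∈ X) :
    torusNorm (x - y) ≤ polymerDiam X :=
  le_trans (Finset.le_sup (f := fun y => torusNorm (x - y)) hy)
    (Finset.le_sup (f := fun x => X.sup fun y => torusNorm (x - y)) hx)

/-- **Finite range of the re-weighting function**: under `HasRange r W`, `h_{W,e,η}` sees the boundary condition
only on the links `z ≠ e` at torus distance `≤ r` from `e` (links of active polymers through `e`). [folklore] -/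
theorem localTilt_congr_of_hasRange {r : ℕ} (hr : HasRange r W) (e : Edge d L) {η η' : GaugeConfig d L (SUN N)}
    (h : ∀ z, z ≠ e → torusNorm (e.1 - z.1) ≤ r → η z = η' z) (g : SUN N) :
    localTilt W e η g = localTilt W e η' g := by
  unfold localTilt
  refine Finset.sum_congr rfl fun X hX => ?_
  by_cases hXr : r < polymerDiam X
  · rw [hr X hXr]; rfl
  · push Not at hXr
    have heX : e.1 ∈ X := (mem_polymersThroughEdge.1 hX).2
    refine W.dependsOn X fun z hz => ?_
    have hzX : z.1 ∈ X := mem_polymerEdges_one.1 (Finset.mem_coe.1 hz)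
    by_cases hze : z = e
    · subst hze; simp
    · rw [update_of_ne hze, update_of_ne hze]
      exact h z hze ((torusNorm_sub_le_polymerDiam heX hzX).trans hXr)

/-- **Finite range of the one-link law of a tier-1 member**: under `HasRange r W` the law at `e` depends on the
boundary condition only through the links `y ≠ e` with `‖e − y‖_∞ ≤ r ⊔ 1` (plaquette neighbours: distance `≤ 1`;
links of active polymers through `e`: distance `≤ r`). [folklore] -/
theorem siteLaw_perturbedTorusSpec_congr_of_hasRange (β : ℝ) {r : ℕ} (hr : HasRange r W) (e : Edge d L)
    {η η' : GaugeConfig d L (SUN N)}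
    (h : ∀ z ∈ (univ.erase e).filter (fun y => torusNorm (e.1 - y.1) ≤ max r 1), η z = η' z) :
    siteLaw (perturbedTorusSpec W β) e η = siteLaw (perturbedTorusSpec W β) e η' := by
  rw [siteLaw_perturbedTorusSpec_eq_tilted_local, siteLaw_perturbedTorusSpec_eq_tilted_local]
  have h1 : ∀ z ∈ linkNbrT e, η z = η' z := fun z hz =>
    h z (Finset.mem_filter.2 ⟨Finset.mem_erase.2 ⟨(mem_linkNbrT_iff.1 hz).1, Finset.mem_univ _⟩,
      (torusNorm_sub_le_one_of_mem_linkNbrT hz).trans (le_max_right _ _)⟩)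
  have h2 : ∀ z, z ≠ e → torusNorm (e.1 - z.1) ≤ r → η z = η' z := fun z hz hzr =>
    h z (Finset.mem_filter.2 ⟨Finset.mem_erase.2 ⟨hz, Finset.mem_univ _⟩, hzr.trans (le_max_left _ _)⟩)
  have hfun : (fun g : SUN N => (∑ q ∈ plaqsThrough e,
      Real.log (wilsonPlaqWeight N β (plaquetteHolonomy (update η e g) q.1 q.2.1.1 q.2.1.2))) - localTilt W e η g) =
      fun g => (∑ q ∈ plaqsThrough e,
        Real.log (wilsonPlaqWeight N β (plaquetteHolonomy (update η' e g) q.1 q.2.1.1 q.2.1.2))) - localTilt W e η' g := by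
    funext g
    rw [localLogWeight_congr β e h1 g, localTilt_congr_of_hasRange hr e h2 g]
  rw [hfun]

end Summit.Ventures.YMGap.RobustBall

end
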